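import Literature.NumberTheory.LFunctions.DeuringHeilbronnTestFunction
import Literature.Analysis.Calculus.LogCutoff
import HarnessLib

/-!
# A smooth weight of Thorner–Zaman type and its Laplace transform

Topic `Literature/NumberTheory/LFunctions`, sub-namespace `TZWeight`. Everything here is PROVED;
the definitions (`tzWeight`, `tzTest`, `edgeConst`) are explicit constructions.

Thorner–Zaman (2019, Lemma 2.2, from [TZ2]) smooth the indicator of `[1/2, 1]` by an `ℓ`-fold
convolution and read off the Laplace transform as a product. We use instead the plateau
`ψ_{x₀,δ}(t) = smoothTransition((x₀ − t)/δ)` of the tree (`DHTest.plateau`, Heath-Brown's test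
functions) and INTEGRATION BY PARTS (`LaplaceShape.shapeLaplace_eq_sum_add`), which gives the same
shape of bounds with order-`2` decay:

* `tzWeight L ε t = ψ_{1+ε/L, ε/L}(t) · (1 − ψ_{1/2, ε/L}(t))` — smooth, `0 ≤ f ≤ 1`, `f = 1` on
  `[1/2, 1]`, `f = 0` off `(1/2 − ε/L, 1 + ε/L)`, in particular `f(0) = 0`;
* `tzTest L ε u = tzWeight L ε (u/L)` — the Ford-scaled test function (`u = log n`, `L = log x`),
  an admissible smoothing (`isSmoothedEFTest_tzTest`) supported in `[L/2 − ε, L + ε]`;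
* derivative bounds `|g^{(k)}| ≤ M/ε^k` (`k = 1, 2`) with the absolute `M` of the tree's
  `Literature.Analysis.Calculus.exists_abs_deriv_and_deriv_deriv_smoothTransition_le` (`LogCutoff.lean`).

The Laplace-transform estimates (trivial, first and second order, and the main-term sandwiches) are
in the second half of the file.

## References

* J. Thorner, A. Zaman, ANT 13 (2019), Lemma 2.2. [ThornerZaman2019]
* D. R. Heath-Brown, PLMS 64 (1992), §7 (plateau test functions). [HeathBrown1992PLMS]
-/

noncomputable section

open Real MeasureTheory Set Filter Topology intervalIntegral

namespace Literature.NumberTheory.LFunctions.TZWeight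

open Literature.NumberTheory.LFunctions.DHTest Literature.NumberTheory.LFunctions.LaplaceShape

/-! ### Bounds for the derivatives of `smoothTransition` and of the plateau -/

/-- The derivatives of `smoothTransition` of orders `1` and `2` vanish off `[0, 1]`
(the tree's `deriv_smoothTransition_of_nonpos` / `_of_one_le` / `deriv_deriv_smoothTransition_eq_zero_off_Icc`
in `iteratedDeriv` form). [folklore] -/
theorem iteratedDeriv_smoothTransition_eq_zero_of_lt {k : ℕ} (hk : k = 1 ∨ k = 2) {y : ℝ} (hy : y < 0 ∨ 1 < y) :
    iteratedDeriv k Real.smoothTransition y = 0 := by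
  rcases hk with rfl | rfl
  · rw [iteratedDeriv_one]
    rcases hy with hy | hy
    · exact Literature.Analysis.Calculus.deriv_smoothTransition_of_nonpos hy.le
    · exact Literature.Analysis.Calculus.deriv_smoothTransition_of_one_le hy.le
  · rw [iteratedDeriv_succ, iteratedDeriv_one]
    refine Literature.Analysis.Calculus.deriv_deriv_smoothTransition_eq_zero_off_Icc y ?_
    rw [mem_Icc, not_and_or, not_le, not_le]; exact hy

/-- **An absolute bound for `smoothTransition'` and `smoothTransition''`** in `iteratedDeriv` form,
from the tree's `exists_abs_deriv_and_deriv_deriv_smoothTransition_le`: there is `M ≥ 1` with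
`|smoothTransition^{(k)}(y)| ≤ M` for `k = 1, 2` and all `y`. [folklore] -/
theorem exists_smoothTransition_deriv_bound :
    ∃ M : ℝ, 1 ≤ M ∧ ∀ y : ℝ, |iteratedDeriv 1 Real.smoothTransition y| ≤ M ∧ |iteratedDeriv 2 Real.smoothTransition y| ≤ M := by
  obtain ⟨C, -, h1, h2⟩ := Literature.Analysis.Calculus.exists_abs_deriv_and_deriv_deriv_smoothTransition_le
  refine ⟨max 1 C, le_max_left _ _, fun y ↦ ⟨?_, ?_⟩⟩
  · rw [iteratedDeriv_one]; exact (h1 y).trans (le_max_right _ _)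
  · rw [iteratedDeriv_succ, iteratedDeriv_one]; exact (h2 y).trans (le_max_right _ _)

/-- The plateau as a composition with an affine map: its iterated derivatives,
`ψ^{(k)}(t) = (−1)^k δ^{−k} smoothTransition^{(k)}((x₀ − t)/δ)`. [folklore] -/
theorem iteratedDeriv_plateau (x₀ : ℝ) {δ : ℝ} (hδ : δ ≠ 0) (k : ℕ) (t : ℝ) :
    iteratedDeriv k (plateau x₀ δ) t = (-1) ^ k * (1 / δ) ^ k * iteratedDeriv k Real.smoothTransition ((x₀ - t) / δ) := by
  set g : ℝ → ℝ := fun y ↦ Real.smoothTransition ((1 / δ) * y) with hg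
  have hpl : plateau x₀ δ = fun t ↦ g (x₀ - t) := by
    funext t; simp only [plateau, hg]; congr 1; field_simp
  have h1 : iteratedDeriv k (fun t ↦ g (x₀ - t)) t = (-1 : ℝ) ^ k • iteratedDeriv k g (x₀ - t) := by
    rw [iteratedDeriv_comp_const_sub]
  have h2 : iteratedDeriv k g = fun y ↦ (1 / δ) ^ k * iteratedDeriv k Real.smoothTransition ((1 / δ) * y) :=
    iteratedDeriv_comp_const_mul (Real.smoothTransition.contDiff (n := k)) (1 / δ)
  rw [hpl, h1, h2, smul_eq_mul]
  simp only
  rw [show (1 / δ) * (x₀ - t) = (x₀ - t) / δ by ring]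
  ring

/-- **Bounds for `ψ'`, `ψ''`**: `|ψ'(t)| ≤ M/δ`, `|ψ''(t)| ≤ M/δ²` (`δ > 0`), with the absolute `M` of
`exists_smoothTransition_deriv_bound`; and `ψ' = ψ'' = 0` off `(x₀ − δ, x₀)`. [folklore] -/
theorem abs_deriv_plateau_le {M : ℝ} (hM : ∀ y : ℝ, |iteratedDeriv 1 Real.smoothTransition y| ≤ M ∧ |iteratedDeriv 2 Real.smoothTransition y| ≤ M)
    (x₀ : ℝ) {δ : ℝ} (hδ : 0 < δ) (t : ℝ) :
    |deriv (plateau x₀ δ) t| ≤ M / δ ∧ |iteratedDeriv 2 (plateau x₀ δ) t| ≤ M / δ ^ 2 := by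
  have h1 := iteratedDeriv_plateau x₀ hδ.ne' 1 t
  have h2 := iteratedDeriv_plateau x₀ hδ.ne' 2 t
  rw [iteratedDeriv_one] at h1
  constructor
  · rw [h1, abs_mul, abs_mul]
    simp only [pow_one, abs_neg, abs_one, one_mul, one_div, abs_inv, abs_of_pos hδ]
    calc δ⁻¹ * |iteratedDeriv 1 Real.smoothTransition ((x₀ - t) / δ)| ≤ δ⁻¹ * M :=
          mul_le_mul_of_nonneg_left (hM _).1 (inv_nonneg.2 hδ.le)
      _ = M / δ := by rw [div_eq_inv_mul]
  · rw [h2, abs_mul, abs_mul]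
    simp only [even_two, Even.neg_pow, one_pow, abs_one, one_mul, one_div, inv_pow, abs_inv, abs_pow, abs_of_pos hδ]
    calc (δ ^ 2)⁻¹ * |iteratedDeriv 2 Real.smoothTransition ((x₀ - t) / δ)| ≤ (δ ^ 2)⁻¹ * M :=
          mul_le_mul_of_nonneg_left (hM _).2 (inv_nonneg.2 (by positivity))
      _ = M / δ ^ 2 := by rw [div_eq_inv_mul]

/-- Off the transition interval `(x₀ − δ, x₀)` the plateau is locally constant, so `ψ^{(k)} = 0`
there (`k = 1, 2`). [folklore] -/
theorem iteratedDeriv_plateau_eq_zero (x₀ : ℝ) {δ : ℝ} (hδ : 0 < δ) {k : ℕ} (hk : k = 1 ∨ k = 2) {t : ℝ}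
    (ht : t < x₀ - δ ∨ x₀ < t) : iteratedDeriv k (plateau x₀ δ) t = 0 := by
  rw [iteratedDeriv_plateau x₀ hδ.ne' k t, iteratedDeriv_smoothTransition_eq_zero_of_lt hk, mul_zero]
  rcases ht with ht | ht
  · right; rw [lt_div_iff₀ hδ]; linarith
  · left; rw [div_lt_iff₀ hδ]; linarith

/-! ### The weight -/

/-- **The weight** `f(t) = ψ_{1+ε/L, ε/L}(t) · (1 − ψ_{1/2, ε/L}(t))`: a smooth version of the
indicator of `[1/2, 1]` with transitions of length `ε/L`. [cite: ThornerZaman2019, Lemma 2.2 (i)–(ii)] -/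
def tzWeight (L ε t : ℝ) : ℝ := plateau (1 + ε / L) (ε / L) t * (1 - plateau (1 / 2) (ε / L) t)

variable {L ε : ℝ}

/-- `f` is smooth. [folklore] -/
theorem tzWeight_contDiff (L ε : ℝ) (m : ℕ) : ContDiff ℝ m (tzWeight L ε) :=
  (plateau_contDiff _ _ m).mul (contDiff_const.sub (plateau_contDiff _ _ m))

/-- `f` is continuous. [folklore] -/
theorem tzWeight_continuous (L ε : ℝ) : Continuous (tzWeight L ε) := (tzWeight_contDiff L ε 0).continuous

/-- `0 ≤ f`. [cite: ThornerZaman2019, Lemma 2.2 (i)] -/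
theorem tzWeight_nonneg (L ε t : ℝ) : 0 ≤ tzWeight L ε t :=
  mul_nonneg (plateau_nonneg _ _ _) (sub_nonneg.2 (plateau_le_one _ _ _))

/-- `f ≤ 1`. [cite: ThornerZaman2019, Lemma 2.2 (i)] -/
theorem tzWeight_le_one (L ε t : ℝ) : tzWeight L ε t ≤ 1 := by
  rw [tzWeight]
  have h1 := plateau_le_one (1 + ε / L) (ε / L) t
  have h2 := plateau_nonneg (1 / 2) (ε / L) t
  have h3 := plateau_nonneg (1 + ε / L) (ε / L) t
  have h4 := plateau_le_one (1 / 2) (ε / L) t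
  nlinarith

/-- `f = 1` on `[1/2, 1]`. [cite: ThornerZaman2019, Lemma 2.2 (i)] -/
theorem tzWeight_eq_one (hL : 0 < L) (hε : 0 < ε) {t : ℝ} (ht1 : 1 / 2 ≤ t) (ht2 : t ≤ 1) : tzWeight L ε t = 1 := by
  have hδ : 0 < ε / L := div_pos hε hL
  rw [tzWeight, plateau_eq_one hδ (by linarith), plateau_eq_zero hδ ht1]; ring

/-- `f = 0` on `(−∞, 1/2 − ε/L]`. [cite: ThornerZaman2019, Lemma 2.2 (ii)] -/
theorem tzWeight_eq_zero_of_le (hL : 0 < L) (hε : 0 < ε) {t : ℝ} (ht : t ≤ 1 / 2 - ε / L) : tzWeight L ε t = 0 := by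
  have hδ : 0 < ε / L := div_pos hε hL
  rw [tzWeight, plateau_eq_one hδ ht]; ring

/-- `f = 0` on `[1 + ε/L, ∞)`. [cite: ThornerZaman2019, Lemma 2.2 (ii)] -/
theorem tzWeight_eq_zero_of_ge (hL : 0 < L) (hε : 0 < ε) {t : ℝ} (ht : 1 + ε / L ≤ t) : tzWeight L ε t = 0 := by
  have hδ : 0 < ε / L := div_pos hε hL
  rw [tzWeight, plateau_eq_zero hδ ht]; ring

/-- `f(0) = 0` when `ε/L ≤ 1/2`. [folklore] -/
theorem tzWeight_zero (hL : 0 < L) (hε : 0 < ε) (hεL : ε / L ≤ 1 / 2) : tzWeight L ε 0 = 0 :=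
  tzWeight_eq_zero_of_le hL hε (by linarith)

/-- On `(−∞, 1]` the falling plateau is `1`: `f = 1 − ψ_{1/2}` is non-decreasing there. [folklore] -/
theorem tzWeight_eq_left (hL : 0 < L) (hε : 0 < ε) {t : ℝ} (ht : t ≤ 1) :
    tzWeight L ε t = 1 - plateau (1 / 2) (ε / L) t := by
  have hδ : 0 < ε / L := div_pos hε hL
  rw [tzWeight, plateau_eq_one hδ (by linarith)]; ring

/-- On `[1/2, ∞)` the rising factor is `1`: `f = ψ_{1+ε/L}` is non-increasing there. [folklore] -/
theorem tzWeight_eq_right (hL : 0 < L) (hε : 0 < ε) {t : ℝ} (ht : 1 / 2 ≤ t) :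
    tzWeight L ε t = plateau (1 + ε / L) (ε / L) t := by
  have hδ : 0 < ε / L := div_pos hε hL
  rw [tzWeight, plateau_eq_zero hδ ht]; ring

/-! ### The Ford-scaled test function `g(u) = f(u/L)` -/

/-- The test function fed to the explicit formula: `g(u) = f(u/L)` (`u = log n`, `L = log x`).
[cite: ThornerZaman2019, (2.3) and Lemma 2.2] -/
def tzTest (L ε u : ℝ) : ℝ := tzWeight L ε (u / L)

/-- `g` is smooth. [folklore] -/
theorem tzTest_contDiff (L ε : ℝ) (m : ℕ) : ContDiff ℝ m (tzTest L ε) :=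
  (tzWeight_contDiff L ε m).comp (contDiff_id.div_const L)

/-- `g` is continuous. [folklore] -/
theorem tzTest_continuous (L ε : ℝ) : Continuous (tzTest L ε) := (tzTest_contDiff L ε 0).continuous

/-- `0 ≤ g ≤ 1`. [folklore] -/
theorem tzTest_mem_Icc (L ε u : ℝ) : tzTest L ε u ∈ Icc (0 : ℝ) 1 := ⟨tzWeight_nonneg _ _ _, tzWeight_le_one _ _ _⟩

/-- `g = 0` on `[L + ε, ∞)`. [folklore] -/
theorem tzTest_eq_zero_of_ge (hL : 0 < L) (hε : 0 < ε) {u : ℝ} (hu : L + ε ≤ u) : tzTest L ε u = 0 := by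
  refine tzWeight_eq_zero_of_ge hL hε ?_
  rw [le_div_iff₀ hL]; field_simp; nlinarith [div_mul_cancel₀ ε hL.ne']

/-- `g = 0` on `(−∞, L/2 − ε]`. [folklore] -/
theorem tzTest_eq_zero_of_le (hL : 0 < L) (hε : 0 < ε) {u : ℝ} (hu : u ≤ L / 2 - ε) : tzTest L ε u = 0 := by
  refine tzWeight_eq_zero_of_le hL hε ?_
  rw [div_le_iff₀ hL]
  have : (1 / 2 - ε / L) * L = L / 2 - ε := by field_simp
  rw [this]; exact hu

/-- `g = 1` on `[L/2, L]`. [folklore] -/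
theorem tzTest_eq_one (hL : 0 < L) (hε : 0 < ε) {u : ℝ} (hu1 : L / 2 ≤ u) (hu2 : u ≤ L) : tzTest L ε u = 1 := by
  refine tzWeight_eq_one hL hε ?_ ?_
  · rw [le_div_iff₀ hL]; linarith
  · rw [div_le_one hL]; exact hu2

/-- `g(0) = 0` (`0 < ε ≤ L/2`). [folklore] -/
theorem tzTest_zero (hL : 0 < L) (hε : 0 < ε) (hεL : ε ≤ L / 2) : tzTest L ε 0 = 0 :=
  tzTest_eq_zero_of_le hL hε (by linarith)

/-- **`g` is an admissible smoothing** for the exact explicit formulae (`C^∞`, `= 0` on `[L + ε, ∞)`,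
all derivatives vanishing at `L + ε`). [cite: Ford2002Millennium, Lemma 4.5 (Remark)] -/
theorem isSmoothedEFTest_tzTest (hL : 0 < L) (hε : 0 < ε) :
    IsSmoothedEFTest (tzTest L ε) (tzTest L ε) (deriv (tzTest L ε)) (deriv (deriv (tzTest L ε))) (L + ε) where
  cont := tzTest_continuous L ε
  x₀_nonneg := by linarith
  eqOn := fun _ _ ↦ rfl
  eq_zero := fun _ hu ↦ tzTest_eq_zero_of_ge hL hε hu
  hasDerivAt := fun t ↦ (((tzTest_contDiff L ε 1).differentiable (by simp)) t).hasDerivAt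
  hasDerivAt' := fun t ↦ by
    have h := (tzTest_contDiff L ε 2).differentiable_iteratedDeriv' 1
    rw [iteratedDeriv_one] at h
    exact (h t).hasDerivAt
  cont'' := by
    have h := (tzTest_contDiff L ε 2).continuous_iteratedDeriv 2 le_rfl
    rwa [iteratedDeriv_succ, iteratedDeriv_one] at h
  p_x₀ := tzTest_eq_zero_of_ge hL hε le_rfl
  p'_x₀ := by
    have h := iteratedDeriv_eq_zero_of_eq_zero (tzTest_contDiff L ε) (fun u hu ↦ tzTest_eq_zero_of_ge hL hε hu) 1
    rwa [iteratedDeriv_one] at h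

/-! ### Derivatives of `g`: size `M/ε^k` on the two edges, zero elsewhere -/

/-- Near `u < L` the test function is `1 − ψ_{1/2, ε/L}(u/L)`; near `u > L/2` it is `ψ_{1+ε/L, ε/L}(u/L)`. [folklore] -/
theorem tzTest_eventuallyEq_left (hL : 0 < L) (hε : 0 < ε) {u : ℝ} (hu : u < L) :
    tzTest L ε =ᶠ[𝓝 u] fun v ↦ 1 - plateau (1 / 2) (ε / L) ((1 / L) * v) := by
  filter_upwards [Iio_mem_nhds hu] with v hv
  rw [tzTest, tzWeight_eq_left hL hε ((div_le_one hL).2 (le_of_lt hv))]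
  congr 2; ring

/-- See `tzTest_eventuallyEq_left`. [folklore] -/
theorem tzTest_eventuallyEq_right (hL : 0 < L) (hε : 0 < ε) {u : ℝ} (hu : L / 2 < u) :
    tzTest L ε =ᶠ[𝓝 u] fun v ↦ plateau (1 + ε / L) (ε / L) ((1 / L) * v) := by
  filter_upwards [Ioi_mem_nhds hu] with v hv
  have hv' : L / 2 < v := hv
  rw [tzTest, tzWeight_eq_right hL hε (by rw [le_div_iff₀ hL]; linarith)]
  congr 1; ring

/-- **`|g^{(k)}(u)| ≤ M/ε^k`** for `k = 1, 2` and all `u`, and **`g^{(k)}(u) = 0`** off the two edges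
`(L/2 − ε, L/2) ∪ (L, L + ε)`. [folklore] -/
theorem abs_iteratedDeriv_tzTest_le {M : ℝ} (hM : ∀ y : ℝ, |iteratedDeriv 1 Real.smoothTransition y| ≤ M ∧ |iteratedDeriv 2 Real.smoothTransition y| ≤ M)
    (hL : 0 < L) (hε : 0 < ε) {k : ℕ} (hk : k = 1 ∨ k = 2) (u : ℝ) :
    |iteratedDeriv k (tzTest L ε) u| ≤ M / ε ^ k ∧
      ((u < L / 2 - ε ∨ (L / 2 < u ∧ u < L) ∨ L + ε < u) → iteratedDeriv k (tzTest L ε) u = 0) := by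
  have hδ : 0 < ε / L := div_pos hε hL
  have hk1 : 1 ≤ k := by rcases hk with rfl | rfl <;> norm_num
  have hk0 : 0 < k := by omega
  have hM0 : 0 ≤ M := le_trans (abs_nonneg _) (hM 0).1
  have hψ : ∀ (x₀ y : ℝ), |iteratedDeriv k (plateau x₀ (ε / L)) y| ≤ M / (ε / L) ^ k := by
    intro x₀ y
    rcases hk with rfl | rfl
    · have := (abs_deriv_plateau_le hM x₀ hδ y).1
      rwa [iteratedDeriv_one, pow_one]
    · exact (abs_deriv_plateau_le hM x₀ hδ y).2
  have hcomp : ∀ (x₀ v : ℝ), iteratedDeriv k (fun v ↦ plateau x₀ (ε / L) ((1 / L) * v)) v =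
      (1 / L) ^ k * iteratedDeriv k (plateau x₀ (ε / L)) ((1 / L) * v) := by
    intro x₀ v
    have := iteratedDeriv_comp_const_mul (plateau_contDiff x₀ (ε / L) k) (1 / L)
    exact congrFun this v
  have hcomp' : ∀ (x₀ v : ℝ), iteratedDeriv k (fun v ↦ 1 - plateau x₀ (ε / L) ((1 / L) * v)) v =
      -((1 / L) ^ k * iteratedDeriv k (plateau x₀ (ε / L)) ((1 / L) * v)) := by
    intro x₀ v
    rw [iteratedDeriv_const_sub hk0, iteratedDeriv_neg, hcomp]
  -- the scaled bound `(1/L)^k · M/(ε/L)^k = M/ε^k`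
  have hscale : (1 / L) ^ k * (M / (ε / L) ^ k) = M / ε ^ k := by
    rw [show (1 / L) ^ k = 1 / L ^ k by rw [div_pow, one_pow], show (ε / L) ^ k = ε ^ k / L ^ k by rw [div_pow]]
    field_simp
  have hkey : ∀ (x₀ v : ℝ), |(1 / L) ^ k * iteratedDeriv k (plateau x₀ (ε / L)) ((1 / L) * v)| ≤ M / ε ^ k := by
    intro x₀ v
    rw [abs_mul, abs_of_pos (by positivity : (0:ℝ) < (1 / L) ^ k), ← hscale]
    exact mul_le_mul_of_nonneg_left (hψ x₀ _) (by positivity)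
  rcases lt_or_ge u L with hu | hu
  · -- left form
    have hev := (tzTest_eventuallyEq_left hL hε hu).iteratedDeriv k
    rw [hev.eq_of_nhds, hcomp']
    refine ⟨by rw [abs_neg]; exact hkey _ _, fun hcase ↦ ?_⟩
    rw [neg_eq_zero, mul_eq_zero]; right
    refine iteratedDeriv_plateau_eq_zero (1 / 2) hδ hk ?_
    rcases hcase with h | ⟨h1, -⟩ | h
    · left
      have : (1 / L) * u < 1 / 2 - ε / L := by
        rw [show (1 / L) * u = u / L by ring, div_lt_iff₀ hL]
        have : (1 / 2 - ε / L) * L = L / 2 - ε := by field_simp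
        linarith
      exact this
    · right; rw [show (1 / L) * u = u / L by ring, lt_div_iff₀ hL]; linarith
    · exfalso; linarith
  · -- right form (`u ≥ L > L/2`)
    have hu' : L / 2 < u := by linarith
    have hev := (tzTest_eventuallyEq_right hL hε hu').iteratedDeriv k
    rw [hev.eq_of_nhds, hcomp]
    refine ⟨hkey _ _, fun hcase ↦ ?_⟩
    rw [mul_eq_zero]; right
    refine iteratedDeriv_plateau_eq_zero (1 + ε / L) hδ hk ?_
    rcases hcase with h | ⟨-, h2⟩ | h
    · exfalso; linarith
    · exfalso; linarith
    · right
      rw [show (1 / L) * u = u / L by ring, lt_div_iff₀ hL]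
      have : (1 + ε / L) * L = L + ε := by field_simp
      linarith

/-- `∫ₐᵇ |φ| = 0` when `φ = 0` on the open interval `(a, b)`, `a ≤ b`. [folklore] -/
theorem intervalIntegral_abs_eq_zero {φ : ℝ → ℝ} {a b : ℝ} (hab : a ≤ b) (h : ∀ t ∈ Ioo a b, φ t = 0) :
    ∫ t in a..b, |φ t| = 0 := by
  rw [intervalIntegral.integral_of_le hab, integral_Ioc_eq_integral_Ioo,
    setIntegral_congr_fun measurableSet_Ioo (fun t ht ↦ by rw [h t ht, abs_zero])]
  simp

/-- `∫ₐᵇ |φ| ≤ (b − a) C` when `|φ| ≤ C` everywhere (`a ≤ b`). [folklore] -/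
theorem intervalIntegral_abs_le {φ : ℝ → ℝ} {a b C : ℝ} (hab : a ≤ b) (h : ∀ t, |φ t| ≤ C) :
    ∫ t in a..b, |φ t| ≤ (b - a) * C := by
  have h1 : ‖∫ t in a..b, |φ t|‖ ≤ C * |b - a| :=
    intervalIntegral.norm_integral_le_of_norm_le_const fun t _ ↦ by rw [Real.norm_eq_abs, abs_abs]; exact h t
  rw [Real.norm_eq_abs, abs_of_nonneg (by linarith : (0:ℝ) ≤ b - a)] at h1
  have h2 : (∫ t in a..b, |φ t|) ≤ abs (∫ t in a..b, |φ t|) := le_abs_self _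
  linarith

/-- **`∫₀^{L+ε} |g^{(k)}| ≤ 2ε · M/ε^k`** (`k = 1, 2`; `0 < ε ≤ L/2`): the derivative lives on two
edges of length `ε`. [folklore] -/
theorem integral_abs_iteratedDeriv_tzTest_le {M : ℝ} (hM : ∀ y : ℝ, |iteratedDeriv 1 Real.smoothTransition y| ≤ M ∧ |iteratedDeriv 2 Real.smoothTransition y| ≤ M)
    (hL : 0 < L) (hε : 0 < ε) (hεL : ε ≤ L / 2) {k : ℕ} (hk : k = 1 ∨ k = 2) :
    ∫ u in (0 : ℝ)..(L + ε), |iteratedDeriv k (tzTest L ε) u| ≤ 2 * ε * (M / ε ^ k) := by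
  set φ := iteratedDeriv k (tzTest L ε) with hφ
  have hcont : Continuous φ := (tzTest_contDiff L ε k).continuous_iteratedDeriv k (by exact_mod_cast le_rfl)
  have hint : ∀ a b : ℝ, IntervalIntegrable (fun u ↦ |φ u|) volume a b := fun a b ↦
    (continuous_abs.comp hcont).intervalIntegrable _ _
  have hb : ∀ u, |φ u| ≤ M / ε ^ k := fun u ↦ (abs_iteratedDeriv_tzTest_le hM hL hε hk u).1
  have hz : ∀ u, (u < L / 2 - ε ∨ (L / 2 < u ∧ u < L) ∨ L + ε < u) → φ u = 0 :=
    fun u hu ↦ (abs_iteratedDeriv_tzTest_le hM hL hε hk u).2 hu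
  -- split `[0, L+ε]` at `L/2 − ε`, `L/2`, `L`
  have hsplit : ∫ u in (0 : ℝ)..(L + ε), |φ u| =
      (∫ u in (0 : ℝ)..(L / 2 - ε), |φ u|) + (∫ u in (L / 2 - ε)..(L / 2), |φ u|) +
        (∫ u in (L / 2)..L, |φ u|) + ∫ u in L..(L + ε), |φ u| := by
    have e1 := intervalIntegral.integral_add_adjacent_intervals (hint 0 (L / 2 - ε)) (hint (L / 2 - ε) (L / 2))
    have e2 := intervalIntegral.integral_add_adjacent_intervals (hint 0 (L / 2)) (hint (L / 2) L)
    have e3 := intervalIntegral.integral_add_adjacent_intervals (hint 0 L) (hint L (L + ε))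
    linarith
  rw [hsplit, intervalIntegral_abs_eq_zero (by linarith) (fun t ht ↦ hz t (Or.inl ht.2)),
    intervalIntegral_abs_eq_zero (by linarith) (fun t ht ↦ hz t (Or.inr (Or.inl ⟨ht.1, ht.2⟩)))]
  have h2 := intervalIntegral_abs_le (φ := φ) (a := L / 2 - ε) (b := L / 2) (by linarith) hb
  have h4 := intervalIntegral_abs_le (φ := φ) (a := L) (b := L + ε) (by linarith) hb
  have : (L / 2 - (L / 2 - ε)) = ε := by ring
  rw [this] at h2
  have : (L + ε - L) = ε := by ring
  rw [this] at h4
  linarith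

/-! ### The Laplace transform: integration by parts and decay -/

/-- All derivatives of `g` vanish at `0` (`g = 0` near `0`, since `ε < L/2`). [folklore] -/
theorem iteratedDeriv_tzTest_zero (hL : 0 < L) (hε : 0 < ε) (hεL : ε < L / 2) (j : ℕ) :
    iteratedDeriv j (tzTest L ε) 0 = 0 := by
  have hloc : tzTest L ε =ᶠ[𝓝 0] fun _ ↦ (0 : ℝ) := by
    filter_upwards [Iio_mem_nhds (show (0 : ℝ) < L / 2 - ε by linarith)] with u hu using
      tzTest_eq_zero_of_le hL hε (le_of_lt hu)
  rw [hloc.iteratedDeriv_eq j, iteratedDeriv_const]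
  rcases j with _ | j <;> simp

/-- The Laplace transform of `g` is the truncated one on `[0, L + ε]`. [folklore] -/
theorem fordLaplace_tzTest_eq (hL : 0 < L) (hε : 0 < ε) (w : ℂ) :
    fordLaplace (tzTest L ε) w = shapeLaplace (tzTest L ε) (L + ε) w :=
  fordLaplace_eq_intervalIntegral (by linarith) (fun _ _ ↦ rfl) (fun u hu ↦ tzTest_eq_zero_of_ge hL hε hu)
    (tzTest_continuous L ε) w

/-- **`k` integrations by parts**: `F(w) = w^{−k} ∫₀^{L+ε} g^{(k)}(u) e^{−wu} du` (`w ≠ 0`).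
[cite: ThornerZaman2019, Lemma 2.2 (iv) (decay)] -/
theorem fordLaplace_tzTest_eq_ibp (hL : 0 < L) (hε : 0 < ε) (hεL : ε < L / 2) {w : ℂ} (hw : w ≠ 0) (k : ℕ) :
    fordLaplace (tzTest L ε) w = (w ^ k)⁻¹ * shapeLaplace (iteratedDeriv k (tzTest L ε)) (L + ε) w := by
  rw [fordLaplace_tzTest_eq hL hε, shapeLaplace_eq_sum_add (tzTest_contDiff L ε)
    (fun u hu ↦ tzTest_eq_zero_of_ge hL hε hu) hw k]
  simp [iteratedDeriv_tzTest_zero hL hε hεL]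

/-- The size of `e^{−wu}` on the support of `g`: `E(w) = max(e^{−Re w (L/2 − ε)}, e^{−Re w (L + ε)})`.
[cite: ThornerZaman2019, Lemma 2.2 (iv), (vi)] -/
def edgeExp (L ε : ℝ) (w : ℂ) : ℝ := max (Real.exp (-(w.re * (L / 2 - ε)))) (Real.exp (-(w.re * (L + ε))))

/-- `E(w) > 0`. [folklore] -/
theorem edgeExp_pos (L ε : ℝ) (w : ℂ) : 0 < edgeExp L ε w := lt_max_of_lt_left (Real.exp_pos _)

/-- On `[L/2 − ε, L + ε]`: `e^{−Re w · u} ≤ E(w)` (monotonicity of the exponential). [folklore] -/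
theorem exp_le_edgeExp {L ε : ℝ} {w : ℂ} {u : ℝ} (hu1 : L / 2 - ε ≤ u) (hu2 : u ≤ L + ε) :
    Real.exp (-(w.re * u)) ≤ edgeExp L ε w := by
  rw [edgeExp]
  rcases le_or_gt 0 w.re with h | h
  · exact le_max_of_le_left (Real.exp_le_exp.2 (by nlinarith))
  · exact le_max_of_le_right (Real.exp_le_exp.2 (by nlinarith))

/-- **The weighted `L¹` bound**: if `φ` vanishes off `[L/2 − ε, L + ε]` and `∫₀^{L+ε}|φ| ≤ I`, then
`‖∫₀^{L+ε} φ e^{−wu}‖ ≤ E(w) · I`. [folklore] -/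
theorem norm_shapeLaplace_le_edgeExp_mul {φ : ℝ → ℝ} (hφc : Continuous φ) (hε : 0 < ε) (hεL : ε < L / 2)
    (hφ0 : ∀ u, u < L / 2 - ε → φ u = 0) {I : ℝ} (hI : ∫ u in (0 : ℝ)..(L + ε), |φ u| ≤ I) (w : ℂ) :
    ‖shapeLaplace φ (L + ε) w‖ ≤ edgeExp L ε w * I := by
  have hX : 0 ≤ L + ε := by linarith
  refine (norm_shapeLaplace_le φ hX w).trans ?_
  have hE := edgeExp_pos L ε w
  calc ∫ u in (0 : ℝ)..(L + ε), |φ u| * Real.exp (-(w.re * u))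
      ≤ ∫ u in (0 : ℝ)..(L + ε), |φ u| * edgeExp L ε w := by
        refine intervalIntegral.integral_mono_on hX ?_ ?_ fun u hu ↦ ?_
        · exact ((continuous_abs.comp hφc).mul (by fun_prop)).intervalIntegrable _ _
        · exact ((continuous_abs.comp hφc).mul continuous_const).intervalIntegrable _ _
        · rcases lt_or_ge u (L / 2 - ε) with h | h
          · rw [hφ0 u h, abs_zero, zero_mul, zero_mul]
          · exact mul_le_mul_of_nonneg_left (exp_le_edgeExp h hu.2) (abs_nonneg _)
    _ = edgeExp L ε w * ∫ u in (0 : ℝ)..(L + ε), |φ u| := by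
        rw [intervalIntegral.integral_mul_const, mul_comm]
    _ ≤ edgeExp L ε w * I := mul_le_mul_of_nonneg_left hI hE.le

/-- **The trivial bound** `‖F(w)‖ ≤ E(w)(L + ε)`. [cite: ThornerZaman2019, Lemma 2.2 (iv)] -/
theorem norm_fordLaplace_tzTest_le₀ (hL : 0 < L) (hε : 0 < ε) (hεL : ε < L / 2) (w : ℂ) :
    ‖fordLaplace (tzTest L ε) w‖ ≤ edgeExp L ε w * (L + ε) := by
  rw [fordLaplace_tzTest_eq hL hε]
  refine norm_shapeLaplace_le_edgeExp_mul (tzTest_continuous L ε) hε hεL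
    (fun u hu ↦ tzTest_eq_zero_of_le hL hε hu.le) ?_ w
  have := intervalIntegral_abs_le (φ := tzTest L ε) (a := 0) (b := L + ε) (C := 1) (by linarith)
    (fun u ↦ by rw [abs_of_nonneg (tzTest_mem_Icc L ε u).1]; exact (tzTest_mem_Icc L ε u).2)
  linarith

/-- **The decay bounds**: with the absolute `M` of `exists_smoothTransition_deriv_bound`, for `w ≠ 0`,
`‖F(w)‖ ≤ E(w) · 2M/‖w‖` and `‖F(w)‖ ≤ E(w) · (2M/ε)/‖w‖²`. [cite: ThornerZaman2019, Lemma 2.2 (iv), (vi)] -/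
theorem norm_fordLaplace_tzTest_le {M : ℝ} (hM : ∀ y : ℝ, |iteratedDeriv 1 Real.smoothTransition y| ≤ M ∧ |iteratedDeriv 2 Real.smoothTransition y| ≤ M)
    (hL : 0 < L) (hε : 0 < ε) (hεL : ε < L / 2) {w : ℂ} (hw : w ≠ 0) :
    ‖fordLaplace (tzTest L ε) w‖ ≤ edgeExp L ε w * (2 * M) / ‖w‖ ∧
      ‖fordLaplace (tzTest L ε) w‖ ≤ edgeExp L ε w * (2 * M / ε) / ‖w‖ ^ 2 := by
  have key : ∀ {k : ℕ}, (k = 1 ∨ k = 2) →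
      ‖fordLaplace (tzTest L ε) w‖ ≤ edgeExp L ε w * (2 * ε * (M / ε ^ k)) / ‖w‖ ^ k := by
    intro k hk
    rw [fordLaplace_tzTest_eq_ibp hL hε hεL hw k, norm_mul, norm_inv, norm_pow, mul_comm, ← div_eq_mul_inv]
    refine div_le_div_of_nonneg_right ?_ (by positivity)
    refine norm_shapeLaplace_le_edgeExp_mul ((tzTest_contDiff L ε k).continuous_iteratedDeriv k (by exact_mod_cast le_rfl))
      hε hεL (fun u hu ↦ (abs_iteratedDeriv_tzTest_le hM hL hε hk u).2 (Or.inl hu)) ?_ w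
    exact integral_abs_iteratedDeriv_tzTest_le hM hL hε hεL.le hk
  constructor
  · have h := key (Or.inl rfl)
    rw [pow_one, pow_one] at h
    convert h using 2; field_simp
  · have h := key (Or.inr rfl)
    convert h using 2; field_simp

/-! ### Real arguments: the main-term sandwiches -/

/-- At a real point the Laplace transform of the real weight is real:
`F(−σ) = ∫₀^{L+ε} g(u) e^{σu} du`. [folklore] -/
theorem fordLaplace_tzTest_ofReal (hL : 0 < L) (hε : 0 < ε) (σ : ℝ) :
    fordLaplace (tzTest L ε) (-(σ : ℂ)) = ((∫ u in (0 : ℝ)..(L + ε), tzTest L ε u * Real.exp (σ * u) : ℝ) : ℂ) := by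
  rw [fordLaplace_tzTest_eq hL hε, shapeLaplace, ← intervalIntegral.integral_ofReal]
  refine intervalIntegral.integral_congr fun u _ ↦ ?_
  push_cast
  ring_nf

/-- **The sandwich**: for a continuous `h ≥ 0`,
`∫_{L/2}^{L} h ≤ ∫₀^{L+ε} g·h ≤ ∫_{L/2−ε}^{L+ε} h` (`0 < ε < L/2`). [cite: ThornerZaman2019, Lemma 2.2 (v) (proof)] -/
theorem sandwich_tzTest {h : ℝ → ℝ} (hc : Continuous h) (h0 : ∀ u, 0 ≤ h u) (hL : 0 < L) (hε : 0 < ε) (hεL : ε < L / 2) :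
    (∫ u in (L / 2)..L, h u) ≤ ∫ u in (0 : ℝ)..(L + ε), tzTest L ε u * h u ∧
      (∫ u in (0 : ℝ)..(L + ε), tzTest L ε u * h u) ≤ ∫ u in (L / 2 - ε)..(L + ε), h u := by
  set g := tzTest L ε with hg
  have hgc : Continuous g := tzTest_continuous L ε
  have hint : ∀ a b : ℝ, IntervalIntegrable (fun u ↦ g u * h u) volume a b := fun a b ↦ (hgc.mul hc).intervalIntegrable _ _
  have hinth : ∀ a b : ℝ, IntervalIntegrable h volume a b := fun a b ↦ hc.intervalIntegrable _ _
  have hgh0 : ∀ u, 0 ≤ g u * h u := fun u ↦ mul_nonneg (tzTest_mem_Icc L ε u).1 (h0 u)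
  -- split `[0, L+ε]` as `[0, L/2−ε] ∪ [L/2−ε, L+ε]` and note `g h = 0` on the first piece
  have hsplit : ∫ u in (0 : ℝ)..(L + ε), g u * h u = ∫ u in (L / 2 - ε)..(L + ε), g u * h u := by
    have e := intervalIntegral.integral_add_adjacent_intervals (hint 0 (L / 2 - ε)) (hint (L / 2 - ε) (L + ε))
    have hz : ∫ u in (0 : ℝ)..(L / 2 - ε), g u * h u = 0 := by
      rw [intervalIntegral.integral_of_le (by linarith)]
      refine setIntegral_eq_zero_of_forall_eq_zero fun u hu ↦ ?_
      rw [hg, tzTest_eq_zero_of_le hL hε hu.2, zero_mul]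
    linarith
  constructor
  · -- lower bound: restrict to `[L/2, L]` where `g = 1`
    rw [hsplit]
    have e2 := intervalIntegral.integral_add_adjacent_intervals (hint (L / 2 - ε) (L / 2)) (hint (L / 2) (L + ε))
    have e3 := intervalIntegral.integral_add_adjacent_intervals (hint (L / 2) L) (hint L (L + ε))
    have p1 : 0 ≤ ∫ u in (L / 2 - ε)..(L / 2), g u * h u := intervalIntegral.integral_nonneg (by linarith) fun u _ ↦ hgh0 u
    have p3 : 0 ≤ ∫ u in L..(L + ε), g u * h u := intervalIntegral.integral_nonneg (by linarith) fun u _ ↦ hgh0 u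
    have hmid : ∫ u in (L / 2)..L, g u * h u = ∫ u in (L / 2)..L, h u := by
      refine intervalIntegral.integral_congr fun u hu ↦ ?_
      rw [uIcc_of_le (by linarith)] at hu
      simp only [hg, tzTest_eq_one hL hε hu.1 hu.2, one_mul]
    linarith
  · rw [hsplit]
    refine intervalIntegral.integral_mono_on (by linarith) (hint _ _) (hinth _ _) fun u _ ↦ ?_
    calc g u * h u ≤ 1 * h u := mul_le_mul_of_nonneg_right (tzTest_mem_Icc L ε u).2 (h0 u)
      _ = h u := one_mul _

/-- **The main term** `F(−σ)` for real `σ ≠ 0`: with `x = e^L`,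
`(x^σ − x^{σ/2})/σ ≤ F(−σ) ≤ (x^σ e^{σε} − x^{σ/2}e^{−σε})/σ` in the sense
`∫_{L/2}^{L} e^{σu} du ≤ Re F(−σ) ≤ ∫_{L/2−ε}^{L+ε} e^{σu} du`. [cite: ThornerZaman2019, Lemma 2.2 (v)] -/
theorem fordLaplace_tzTest_real_mem (hL : 0 < L) (hε : 0 < ε) (hεL : ε < L / 2) (σ : ℝ) :
    (∫ u in (L / 2)..L, Real.exp (σ * u)) ≤ (fordLaplace (tzTest L ε) (-(σ : ℂ))).re ∧
      (fordLaplace (tzTest L ε) (-(σ : ℂ))).re ≤ ∫ u in (L / 2 - ε)..(L + ε), Real.exp (σ * u) := by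
  rw [fordLaplace_tzTest_ofReal hL hε σ, Complex.ofReal_re]
  exact sandwich_tzTest (h := fun u ↦ Real.exp (σ * u)) (by fun_prop) (fun u ↦ (Real.exp_pos _).le) hL hε hεL

/-- **The difference of two main terms** `F(−1) − F(−σ)` (`σ ≤ 1`): the same sandwich for the
non-negative integrand `e^{u} − e^{σu}` on `u ≥ 0`. [cite: ThornerZaman2019, Lemma 2.2 (v)] -/
theorem fordLaplace_tzTest_real_sub_mem (hL : 0 < L) (hε : 0 < ε) (hεL : ε < L / 2) {σ : ℝ} (hσ : σ ≤ 1) :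
    (∫ u in (L / 2)..L, (Real.exp u - Real.exp (σ * u))) ≤
        (fordLaplace (tzTest L ε) (-(1 : ℂ)) - fordLaplace (tzTest L ε) (-(σ : ℂ))).re ∧
      (fordLaplace (tzTest L ε) (-(1 : ℂ)) - fordLaplace (tzTest L ε) (-(σ : ℂ))).re ≤
        ∫ u in (L / 2 - ε)..(L + ε), (Real.exp u - Real.exp (σ * u)) := by
  have h1 := fordLaplace_tzTest_ofReal hL hε 1
  push_cast at h1
  simp only [one_mul] at h1
  have hsub : (∫ u in (0 : ℝ)..(L + ε), tzTest L ε u * Real.exp u) - (∫ u in (0 : ℝ)..(L + ε), tzTest L ε u * Real.exp (σ * u)) =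
      ∫ u in (0 : ℝ)..(L + ε), tzTest L ε u * (Real.exp u - Real.exp (σ * u)) := by
    have hi1 : IntervalIntegrable (fun u ↦ tzTest L ε u * Real.exp u) volume 0 (L + ε) :=
      ((tzTest_continuous L ε).mul Real.continuous_exp).intervalIntegrable _ _
    have hi2 : IntervalIntegrable (fun u ↦ tzTest L ε u * Real.exp (σ * u)) volume 0 (L + ε) :=
      ((tzTest_continuous L ε).mul (Real.continuous_exp.comp (continuous_const.mul continuous_id))).intervalIntegrable _ _
    rw [← intervalIntegral.integral_sub hi1 hi2]
    refine intervalIntegral.integral_congr fun u _ ↦ ?_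
    ring
  rw [h1, fordLaplace_tzTest_ofReal hL hε σ, ← Complex.ofReal_sub, Complex.ofReal_re, hsub]
  -- the integrand `e^u − e^{σu}` is `≥ 0` for `u ≥ 0`; the sandwich only needs it on the real line where `g ≠ 0`,
  -- i.e. `u ≥ L/2 − ε > 0`; we apply it to `max 0 (e^u − e^{σu})`-free version via a direct argument
  have hnonneg : ∀ u, 0 ≤ u → 0 ≤ Real.exp u - Real.exp (σ * u) := by
    intro u hu
    have : σ * u ≤ u := by nlinarith
    linarith [Real.exp_le_exp.2 this]
  -- modify `h` below `0` to be non-negative and continuous: `h u = e^{max u 0}-e^{σ max u 0}`... simpler: use `u ↦ e^u − e^{σu}` restricted is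
  -- fine because all three integrals live on `u ≥ 0`; we run the sandwich with `h u = exp (max u 0) − exp (σ · max u 0)`
  set h : ℝ → ℝ := fun u ↦ Real.exp (max u 0) - Real.exp (σ * max u 0) with hh
  have hc : Continuous h := by rw [hh]; fun_prop
  have h0 : ∀ u, 0 ≤ h u := fun u ↦ hnonneg _ (le_max_right _ _)
  have heq : ∀ u, 0 ≤ u → h u = Real.exp u - Real.exp (σ * u) := fun u hu ↦ by simp [hh, max_eq_left hu]
  obtain ⟨hlo, hhi⟩ := sandwich_tzTest hc h0 hL hε hεL
  have e1 : ∫ u in (L / 2)..L, h u = ∫ u in (L / 2)..L, (Real.exp u - Real.exp (σ * u)) := by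
    refine intervalIntegral.integral_congr fun u hu ↦ ?_
    rw [uIcc_of_le (by linarith)] at hu
    exact heq u (by linarith [hu.1])
  have e2 : ∫ u in (0 : ℝ)..(L + ε), tzTest L ε u * h u = ∫ u in (0 : ℝ)..(L + ε), tzTest L ε u * (Real.exp u - Real.exp (σ * u)) := by
    refine intervalIntegral.integral_congr fun u hu ↦ ?_
    rw [uIcc_of_le (by linarith)] at hu
    simp only [heq u hu.1]
  have e3 : ∫ u in (L / 2 - ε)..(L + ε), h u = ∫ u in (L / 2 - ε)..(L + ε), (Real.exp u - Real.exp (σ * u)) := by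
    refine intervalIntegral.integral_congr fun u hu ↦ ?_
    rw [uIcc_of_le (by linarith)] at hu
    exact heq u (by linarith [hu.1])
  rw [e1, e2] at hlo
  rw [e2, e3] at hhi
  exact ⟨hlo, hhi⟩

/-- The elementary integral `∫ₐᵇ e^{σu} du = (e^{σb} − e^{σa})/σ` (`σ ≠ 0`). [folklore] -/
theorem integral_exp_mul {a b σ : ℝ} (hσ : σ ≠ 0) :
    ∫ u in a..b, Real.exp (σ * u) = (Real.exp (σ * b) - Real.exp (σ * a)) / σ := by
  have h : ∀ u ∈ uIcc a b, HasDerivAt (fun u ↦ Real.exp (σ * u) / σ) (Real.exp (σ * u)) u := by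
    intro u _
    have h1 : HasDerivAt (fun u ↦ σ * u) σ u := by simpa using (hasDerivAt_id u).const_mul σ
    have h2 := h1.exp.div_const σ
    have h3 : Real.exp (σ * u) * σ / σ = Real.exp (σ * u) := by field_simp
    rwa [h3] at h2
  rw [intervalIntegral.integral_eq_sub_of_hasDerivAt h ((by fun_prop : Continuous fun u ↦ Real.exp (σ * u)).intervalIntegrable _ _)]
  ring

end Literature.NumberTheory.LFunctions.TZWeight

end
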